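import Summits.KontsevichZagierPeriods.KontsevichZagierPeriods.Theorems.PlanarAreas.Negative.Rule2LoadBearing

/-!
# `PlanarAreas` (stmt-KontsevichZagierPeriods-4990): negative side — IX. a HORIZONTAL change of variables is load-bearing

Negative-side support for the crux `PlanarAreas` (cdisprove cycle 2; work file
`Cruxes/PlanarAreas/Disproof.lean` §7).  Sharpening of `not_withoutRule2` (Negative/Rule2LoadBearing):
enlarge the change-of-variables-free sub-calculus `closure (1a ∪ 1b ∪ 3)` by every rule-2
instance whose map FIXES THE FIRST COORDINATE on the domain (`fixingFirstCoordCoVRel`: vertical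
translations and shears `(x, y) ↦ (x, y − f x)` of `StackingShear`, fibrewise rescalings
`(x, y) ↦ (x, ψ (x, y))` with any Jacobian, the under-graph lifts of `KZ.exists_underGraph`; in
dimension `1` only the identity).  Such a move maps each first-coordinate window
`domain ∩ {x₀ < e}` onto the corresponding window of the image, so by the Jacobian formula ON THE
WINDOW it preserves every window value `Λₑ = KZ.restrictedEval (win e)`
(`restrictedEval_win_eq_zero_of_mem_fixingFirstCoordCoVRel`); hence the cycle-1 invariant
"`e ↦ Λₑ` is semialgebraic up to a constant" survives in the enlarged sub-calculus
(`winSemialgebraic_of_mem_fixing`), and the cycle-1 witness — the hyperbola region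
`R = {1<x<2, 0<y<1/x}` against its HORIZONTAL translate `R + (3,0)`, window values `log e`
(`not_winSemialgebraic_hyp`) — is still not connected (`not_withoutHorizontalMove`).

DICHOTOMY (tightness inside the file): the VERTICAL translate `R + (0,5)` IS one move of the
enlarged sub-calculus away from `R` (`of_hypRep_sub_of_hypUpRep_mem`), the horizontal translate is
not reachable at all.  So every chain for the crux contains a change of variables that MOVES THE
SLICING COORDINATE — a coordinate swap / rotation, a horizontal translation or shear
`x ↦ φ x` (`FiniteMapShear`, the calibration map of `DiscSectorOneLine`), … ; for line
green-native-bands this is exactly its `stub_swap` between the two Newton–Leibniz directions, which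
therefore cannot be traded for vertical shears.  (For the witness pair the cheapest such move is
the dimension-1 translation `x ↦ x + 3` of Negative/Tightness.)

Everything is sorry-free; axioms ⊆ {propext, Classical.choice, Quot.sound}.

Sources: M. Kontsevich, D. Zagier, *Periods* (2001), §1.2; J. Fresán, *Une introduction aux
périodes* (2024), Rem. 3.6 (no algebraic primitive of `1/(z − 2)`; tree barrier
`noSemialgebraicPrimitive_inv_sub_two`). -/

noncomputable section

open Set MeasureTheory MvPolynomial Filter Topology
open Literature.NumberTheory.Transcendental Literature.ModelTheory.ExponentialFields

namespace Summit.KontsevichZagierPeriods.PlanarAreas.Negative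

open Summit.KontsevichZagierPeriods.KontsevichZagierPeriods.Theses.SymplecticScissors (PlanarAreas)

/-! ## §7a Rule-2 instances fixing the first coordinate preserve the window values -/

/-- The change-of-variables instances (exactly the data of `KZ.changeOfVariablesRel`) whose map
`Φ` FIXES THE FIRST COORDINATE on the domain: `Φ x 0 = x 0` (vacuous in dimension `0`).
A refuter-posited sub-family of rule 2 for the load-bearing analysis. -/
def fixingFirstCoordCoVRel : Set KZ.FormalRep :=
  {c | ∃ (n : ℕ) (r r' : KZ.IntegralRep n) (Φ : (Fin n → ℝ) → (Fin n → ℝ))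
      (Φ' : (Fin n → ℝ) → (Fin n → ℝ) →L[ℝ] (Fin n → ℝ)),
    IsSemialgebraicMapOn ℚ r.domain Φ ∧ (∀ x ∈ r.domain, HasFDerivWithinAt Φ (Φ' x) r.domain x) ∧
    InjOn Φ r.domain ∧ r'.domain = Φ '' r.domain ∧
    (∀ x ∈ r.domain, r.integrand x = r'.integrand (Φ x) * |(Φ' x).det|) ∧
    (∀ x ∈ r.domain, ∀ i : Fin n, (i : ℕ) = 0 → Φ x i = x i) ∧
    c = KZ.of r - KZ.of r'}

/-- These instances are rule-2 instances. [cite: KontsevichZagier2001, §1.2 rule (2)] -/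
theorem fixingFirstCoordCoVRel_subset : fixingFirstCoordCoVRel ⊆ KZ.changeOfVariablesRel := by
  rintro c ⟨n, r, r', Φ, Φ', hΦ, hd, hinj, hdom, hf, -, rfl⟩
  exact ⟨n, r, r', Φ, Φ', hΦ, hd, hinj, hdom, hf, rfl⟩

/-- Hence the enlarged sub-calculus is still a sub-calculus of the KZ moves. [cite: KontsevichZagier2001, §1.2] -/
theorem closure_fixing_le_relations :
    AddSubgroup.closure (KZ.domainAddRel ∪ KZ.integrandAddRel ∪ fixingFirstCoordCoVRel ∪
      KZ.newtonLeibnizRel) ≤ KZ.relations := by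
  refine AddSubgroup.closure_mono ?_
  rintro c (((hc | hc) | hc) | hc)
  · exact Or.inl (Or.inl (Or.inl hc))
  · exact Or.inl (Or.inl (Or.inr hc))
  · exact Or.inl (Or.inr (fixingFirstCoordCoVRel_subset hc))
  · exact Or.inr hc

/-- **A first-coordinate-fixing change of variables preserves every window value**: it maps
`r.domain ∩ {x₀ < e}` onto `r'.domain ∩ {x₀ < e}`, and the Jacobian formula
(`MeasureTheory.integral_image_eq_integral_abs_det_fderiv_smul`) applies on that measurable
subset (derivatives within and injectivity restrict). [cite: KontsevichZagier2001, §1.2 rule (2)] -/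
theorem restrictedEval_win_eq_zero_of_mem_fixingFirstCoordCoVRel (e : ℝ) {c : KZ.FormalRep}
    (hc : c ∈ fixingFirstCoordCoVRel) : KZ.restrictedEval (win e) c = 0 := by
  obtain ⟨n, r, r', Φ, Φ', -, hd, hinj, hdom, hf, hfix, rfl⟩ := hc
  rw [map_sub, KZ.restrictedEval_of, KZ.restrictedEval_of, sub_eq_zero]
  cases n with
  | zero => simp
  | succ k =>
    have hSm : MeasurableSet (r.domain ∩ win e (k + 1)) :=
      (KZ.IntegralRep.measurableSet_domain_holds r).inter (measurableSet_win e _)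
    have hSsub : r.domain ∩ win e (k + 1) ⊆ r.domain := inter_subset_left
    have hd' : ∀ x ∈ r.domain ∩ win e (k + 1),
        HasFDerivWithinAt Φ (Φ' x) (r.domain ∩ win e (k + 1)) x :=
      fun x hx => (hd x (hSsub hx)).mono hSsub
    have hinj' : InjOn Φ (r.domain ∩ win e (k + 1)) := hinj.mono hSsub
    have himg : Φ '' (r.domain ∩ win e (k + 1)) = r'.domain ∩ win e (k + 1) := by
      ext y
      constructor
      · rintro ⟨x, ⟨hx, hxw⟩, rfl⟩
        refine ⟨hdom ▸ mem_image_of_mem Φ hx, ?_⟩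
        rw [mem_win_succ, hfix x hx 0 rfl]
        exact hxw
      · rintro ⟨hy, hyw⟩
        rw [hdom] at hy
        obtain ⟨x, hx, rfl⟩ := hy
        refine ⟨x, ⟨hx, ?_⟩, rfl⟩
        rw [mem_win_succ] at hyw ⊢
        rwa [hfix x hx 0 rfl] at hyw
    rw [← himg, integral_image_eq_integral_abs_det_fderiv_smul volume hSm hd' hinj']
    refine setIntegral_congr_fun hSm fun x hx => ?_
    rw [hf x (hSsub hx), smul_eq_mul, mul_comm]

/-- **The window invariant along the enlarged sub-calculus**: every element of
`closure (1a ∪ 1b ∪ fixingFirstCoordCoVRel ∪ 3)` has first-coordinate window values semialgebraic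
in `e` up to a constant. [cite: KontsevichZagier2001, §1.2] -/
theorem winSemialgebraic_of_mem_fixing {c : KZ.FormalRep}
    (hc : c ∈ AddSubgroup.closure (KZ.domainAddRel ∪ KZ.integrandAddRel ∪ fixingFirstCoordCoVRel ∪
      KZ.newtonLeibnizRel)) :
    WinSemialgebraic c := by
  refine AddSubgroup.closure_induction (p := fun x _ => WinSemialgebraic x) (fun x hx => ?_)
    winSemialgebraic_zero (fun x y _ _ hx hy => hx.add hy) (fun x _ hx => hx.neg) hc
  rcases hx with ((hx | hx) | hx) | hx
  · exact winSemialgebraic_of_eq_zero fun e =>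
      KZ.restrictedEval_eq_zero_of_mem_domainAddRel _ (measurableSet_win e) hx
  · exact winSemialgebraic_of_eq_zero fun e =>
      KZ.restrictedEval_eq_zero_of_mem_integrandAddRel _ (measurableSet_win e) hx
  · exact winSemialgebraic_of_eq_zero fun e =>
      restrictedEval_win_eq_zero_of_mem_fixingFirstCoordCoVRel e hx
  · obtain ⟨n, r, r', a, b, F, hF, ha, hb, hab, hdom, hcont, hderiv, hr', rfl⟩ := hx
    cases n with
    | zero => exact nl_zero_defect r r' a b F hF ha hb hab hdom hcont hderiv
    | succ k =>
      exact winSemialgebraic_of_eq_zero fun e =>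
        restrictedEval_win_nl_succ e r r' a b F hab hdom hcont hderiv hr'

/-! ## §7b The witness pair has non-semialgebraic window values -/

/-- **`[R] − [R + (3,0)]` has NON-semialgebraic window values**: they equal `log e` on `[1,2]`
(`restrictedEval_win_hypRep`, the translate being invisible for `e ≤ 4`), and `t ↦ log (2 − t) + C`
has derivative `1/(t − 2)` on `(0,1)`, which no `ℚ`-semialgebraic function on `[0,1]` has (tree
barrier `noSemialgebraicPrimitive_inv_sub_two_holds`).  (The contradiction step of
`not_withoutRule2`, isolated for reuse.) [cite: Fresan2024, Rem. 3.6] -/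
theorem not_winSemialgebraic_hyp : ¬ WinSemialgebraic (KZ.of hypRep - KZ.of hypShiftRep) := by
  rintro ⟨Φ, K, hΦ, hwin⟩
  have hlog : ∀ e ∈ Icc (1:ℝ) 2, Φ e + K = Real.log e := by
    intro e he
    rw [← hwin e, map_sub, restrictedEval_win_hypRep he,
      restrictedEval_win_hypShiftRep (he.2.trans (by norm_num)), sub_zero]
  have hI : IsSemialgebraic ℚ {x : Fin 1 → ℝ | x 0 ∈ Icc (0:ℝ) 1} := by
    have h0 := isSemialgebraic_setOf_eval_le (k := ℚ) (R := ℝ) (ι := Fin 1) (C 0) (X 0)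
    have h1 := isSemialgebraic_setOf_eval_le (k := ℚ) (R := ℝ) (ι := Fin 1) (X 0) (C 1)
    have hEq : {x : Fin 1 → ℝ | x 0 ∈ Icc (0:ℝ) 1} =
        {x : Fin 1 → ℝ | aeval x (C 0 : MvPolynomial (Fin 1) ℚ) ≤ aeval x (X 0 : MvPolynomial (Fin 1) ℚ)} ∩
        {x : Fin 1 → ℝ | aeval x (X 0 : MvPolynomial (Fin 1) ℚ) ≤ aeval x (C 1 : MvPolynomial (Fin 1) ℚ)} := by
      ext x
      simp
    rw [hEq]
    exact h0.inter h1
  refine Literature.Barriers.KontsevichZagierPeriods.KZ.noSemialgebraicPrimitive_inv_sub_two_holds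
    ⟨fun z => Φ (2 - z 0), ?_, ?_⟩
  · have hm : IsSemialgebraicMapOn ℚ {x : Fin 1 → ℝ | x 0 ∈ Icc (0:ℝ) 1}
        (fun z : Fin 1 → ℝ => fun _ : Fin 1 => 2 - z 0) := by
      have := isSemialgebraicMapOn_aeval (k := ℚ) (R := ℝ) hI
        (fun _ : Fin 1 => (C 2 - X 0 : MvPolynomial (Fin 1) ℚ))
      convert this using 2 with z
      funext j
      simp
    exact IsSemialgebraicFunOn.comp_isSemialgebraicMapOn_holds hΦ hm (fun _ _ => mem_univ _)
  · intro t ht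
    have hEq : (fun s : ℝ => Φ (2 - (fun _ : Fin 1 => s) 0)) =ᶠ[𝓝 t]
        fun s => Real.log (2 - s) - K := by
      filter_upwards [Ioo_mem_nhds ht.1 ht.2] with s hs
      have h2s : 2 - s ∈ Icc (1:ℝ) 2 := ⟨by linarith [hs.2], by linarith [hs.1]⟩
      have := hlog (2 - s) h2s
      show Φ (2 - s) = Real.log (2 - s) - K
      linarith
    refine HasDerivAt.congr_of_eventuallyEq ?_ hEq
    have h1 : HasDerivAt (fun s : ℝ => 2 - s) (-1) t := by
      simpa using (hasDerivAt_id t).const_sub 2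
    have h2 : HasDerivAt (fun s : ℝ => Real.log (2 - s)) ((2 - t)⁻¹ * (-1)) t :=
      (Real.hasDerivAt_log (show (2 - t) ≠ 0 by linarith [ht.2])).comp t h1
    have h3 := h2.sub_const K
    convert h3 using 1
    have : (t - 2) ≠ 0 := by linarith [ht.2]
    have : (2 - t) ≠ 0 := by linarith [ht.2]
    field_simp
    ring

/-! ## §7c The refutation: a horizontal move is load-bearing -/

/-- STRENGTHENING: chains of rules 1a, 1b, 3 (any dimensions) together with the rule-2 instances
that FIX THE FIRST COORDINATE.  A refuter-posited sub-calculus for the load-bearing analysis. -/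
def WithoutHorizontalMove : Prop :=
  ∀ (r r' : KZ.IntegralRep 2), (∀ p ∈ r.domain, r.integrand p = 1) →
    (∀ p ∈ r'.domain, r'.integrand p = 1) → r.value = r'.value →
    KZ.of r - KZ.of r' ∈
      AddSubgroup.closure (KZ.domainAddRel ∪ KZ.integrandAddRel ∪ fixingFirstCoordCoVRel ∪
        KZ.newtonLeibnizRel)

/-- The cycle-1 strengthening `WithoutRule2` is a special case (monotonicity of closures), so
`not_withoutHorizontalMove` below re-proves `not_withoutRule2`. [folklore] -/
theorem withoutHorizontalMove_of_withoutRule2 (h : WithoutRule2) : WithoutHorizontalMove := by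
  intro r r' hr hr' hv
  refine (AddSubgroup.closure_mono ?_) (h r r' hr hr' hv)
  rintro c ((hc | hc) | hc)
  · exact Or.inl (Or.inl (Or.inl hc))
  · exact Or.inl (Or.inl (Or.inr hc))
  · exact Or.inr hc

/-- **A change of variables MOVING THE FIRST COORDINATE is load-bearing.**  The hyperbola region
`R = {1<x<2, 0<y<1/x}` and its horizontal translate `R + (3,0)` (equal area `log 2`) are NOT
connected by rules 1a, 1b, 3 and first-coordinate-fixing changes of variables, through any
dimensions: window values along such chains are semialgebraic up to a constant
(`winSemialgebraic_of_mem_fixing`), those of the pair are `log e` (`not_winSemialgebraic_hyp`).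
Every chain for the crux contains a rule-2 move that does not fix the slicing coordinate (a swap,
a horizontal translation/shear, the calibration map, …). [cite: KontsevichZagier2001, §1.2] -/
theorem not_withoutHorizontalMove : ¬ WithoutHorizontalMove := fun h =>
  not_winSemialgebraic_hyp (winSemialgebraic_of_mem_fixing
    (h hypRep hypShiftRep (fun _ _ => rfl) (fun _ _ => rfl) value_hypRep_eq))

/-! ## §7d Tightness: the VERTICAL translate is one move of the sub-calculus away -/

/-- `R + (0, 5) = {1 < x < 2, 5 < y, x (y − 5) < 1}`. -/
def hypUpSet : Set (Fin 2 → ℝ) := {p | 1 < p 0 ∧ p 0 < 2 ∧ 5 < p 1 ∧ p 0 * (p 1 - 5) < 1}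

/-- The vertical translate is `ℚ`-semialgebraic. [folklore] -/
theorem isSemialgebraic_hypUpSet : IsSemialgebraic ℚ hypUpSet := by
  have h0 := isSemialgebraic_setOf_eval_lt (k := ℚ) (R := ℝ) (ι := Fin 2) (C 1) (X 0)
  have h1 := isSemialgebraic_setOf_eval_lt (k := ℚ) (R := ℝ) (ι := Fin 2) (X 0) (C 2)
  have h2 := isSemialgebraic_setOf_eval_lt (k := ℚ) (R := ℝ) (ι := Fin 2) (C 5) (X 1)
  have h3 := isSemialgebraic_setOf_eval_lt (k := ℚ) (R := ℝ) (ι := Fin 2) (X 0 * (X 1 - C 5)) (C 1)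
  have hEq : hypUpSet =
      {x : Fin 2 → ℝ | aeval x (C 1 : MvPolynomial (Fin 2) ℚ) < aeval x (X 0 : MvPolynomial (Fin 2) ℚ)} ∩
      ({x : Fin 2 → ℝ | aeval x (X 0 : MvPolynomial (Fin 2) ℚ) < aeval x (C 2 : MvPolynomial (Fin 2) ℚ)} ∩
      ({x : Fin 2 → ℝ | aeval x (C 5 : MvPolynomial (Fin 2) ℚ) < aeval x (X 1 : MvPolynomial (Fin 2) ℚ)} ∩
      {x : Fin 2 → ℝ | aeval x (X 0 * (X 1 - C 5) : MvPolynomial (Fin 2) ℚ) < aeval x (C 1 : MvPolynomial (Fin 2) ℚ)})) := by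
    ext p
    simp [hypUpSet]
  rw [hEq]
  exact h0.inter (h1.inter (h2.inter h3))

/-- The vertical translate is the image of `R` under `p ↦ p + (0, 5)`. [folklore] -/
theorem hypUpSet_eq_image :
    hypUpSet = (fun p : Fin 2 → ℝ => p + (![0, 5] : Fin 2 → ℝ)) '' hypSet := by
  ext q
  simp only [hypUpSet, hypSet, mem_setOf_eq, mem_image]
  constructor
  · rintro ⟨h1, h2, h3, h4⟩
    refine ⟨q - ![0, 5], ⟨?_, ?_, ?_, ?_⟩, sub_add_cancel q _⟩
    · simp; linarith
    · simp; linarith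
    · simp; linarith
    · simp; nlinarith
  · rintro ⟨p, ⟨h1, h2, h3, h4⟩, rfl⟩
    simp only [Pi.add_apply, Matrix.cons_val_zero, Matrix.cons_val_one, Matrix.cons_val_fin_one,
      add_zero]
    refine ⟨h1, h2, by linarith, by nlinarith⟩

/-- The vertical translate is a preimage of `R` under a translation, hence has the same area. [folklore] -/
theorem volume_hypUpSet : volume hypUpSet = volume hypSet := by
  have : hypUpSet = (fun p : Fin 2 → ℝ => (![0, -5] : Fin 2 → ℝ) + p) ⁻¹' hypSet := by
    rw [hypUpSet_eq_image]
    ext q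
    simp only [mem_image, mem_preimage]
    constructor
    · rintro ⟨p, hp, rfl⟩
      convert hp using 1
      funext i
      fin_cases i <;> simp [Matrix.vecHead, Matrix.vecTail]
    · intro hq
      refine ⟨![0, -5] + q, hq, ?_⟩
      funext i
      fin_cases i <;> simp [Matrix.vecHead, Matrix.vecTail]
  rw [this]
  exact measure_preimage_add _ _ _

/-- `[R + (0,5), 1]`. -/
def hypUpRep : KZ.IntegralRep 2 :=
  constOneRep hypUpSet isSemialgebraic_hypUpSet (by rw [volume_hypUpSet]; exact volume_hypSet_lt_top.ne)

/-- The domain of `hypUpRep`. -/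
@[simp] theorem hypUpRep_domain : hypUpRep.domain = hypUpSet := rfl

/-- **The vertical translation IS a first-coordinate-fixing change of variables**: `[R] − [R + (0,5)]`
is ONE instance of `fixingFirstCoordCoVRel` (`Φ p = p + (0,5)`, `DΦ = id`, `|det| = 1`).  With
`not_withoutHorizontalMove`: vertical translates of `R` are reachable in the sub-calculus,
horizontal ones are not. [cite: KontsevichZagier2001, §1.2 rule (2)] -/
theorem of_hypRep_sub_of_hypUpRep_mem :
    KZ.of hypRep - KZ.of hypUpRep ∈ fixingFirstCoordCoVRel := by
  refine ⟨2, hypRep, hypUpRep, fun p => p + (![0, 5] : Fin 2 → ℝ),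
    fun _ => ContinuousLinearMap.id ℝ (Fin 2 → ℝ), ?_, ?_, ?_, ?_, ?_, ?_, rfl⟩
  · have := isSemialgebraicMapOn_aeval (k := ℚ) (R := ℝ) hypRep.isSemialgebraic_domain
      (![X 0, X 1 + C 5] : Fin 2 → MvPolynomial (Fin 2) ℚ)
    convert this using 2 with x
    funext j
    fin_cases j <;> simp
  · intro x _
    exact (hasFDerivWithinAt_id x _).add_const _
  · intro x _ y _ hxy
    exact add_right_cancel hxy
  · rw [hypUpRep_domain, hypRep_domain, hypUpSet_eq_image]
  · intro x _
    simp [hypRep, hypUpRep, ContinuousLinearMap.det]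
  · intro x _ i hi
    have : i = 0 := Fin.ext hi
    subst this
    simp

/-- So the vertical pair is equivalent INSIDE the sub-calculus that cannot touch the horizontal
pair. [cite: KontsevichZagier2001, §1.2] -/
theorem of_hypRep_sub_of_hypUpRep_mem_closure :
    KZ.of hypRep - KZ.of hypUpRep ∈
      AddSubgroup.closure (KZ.domainAddRel ∪ KZ.integrandAddRel ∪ fixingFirstCoordCoVRel ∪
        KZ.newtonLeibnizRel) :=
  AddSubgroup.subset_closure (Or.inl (Or.inr of_hypRep_sub_of_hypUpRep_mem))

end Summit.KontsevichZagierPeriods.PlanarAreas.Negative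

end
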